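import Mathlib
import Summits.KontsevichZagierPeriods.KontsevichZagierPeriods.Theses.InverseLandau
import Literature.NumberTheory.Transcendental.KZCalculus
import Literature.NumberTheory.Transcendental.KZLogCalculusProofs
import Literature.NumberTheory.Transcendental.KZProductIdeal
import Literature.NumberTheory.Transcendental.KZSubcalculusInvariants
import Summits.KontsevichZagierPeriods.KontsevichZagierPeriods.Theorems.BetaCancellation.Negative.Torsion
import Summits.KontsevichZagierPeriods.KontsevichZagierPeriods.Theorems.InverseLandauTateLiftingSphereArea

/-!
# `TateLifting` (stmt-KontsevichZagierPeriods-9129), line `Sketch` — stub `tateLifting_unitIntervalSpin`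

`[D̄ × (0,1), 1] − [ℝ², (1+|w|²)⁻²] ∈ KZ.relations`: every three-dimensional integral representation
`ρ` with domain `{z₀² + z₁² ≤ 1, 0 < z₂ < 1}` (closed unit disc times the open unit interval) and
integrand `1` on it differs by relations of the Kontsevich–Zagier calculus from every
two-dimensional representation `R` with domain `ℝ²` and integrand `((1 + (w₀² + w₁²))²)⁻¹` (the
round area form of `S²` in stereographic coordinates, divided by `4`); both have value `π`. This is
verbatim the item `UnitIntervalSpin` (stmt-KontsevichZagierPeriods-16460) of route SpheresForWalls.

## Proof

Both sides are compared with the disc `KZ.piRep = [D̄, 1]`: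

* `[ρ] ≡ [D̄]` (`of_sub_of_piRep_mem_relations_of_disc_slab`): the closed slab
  `KZ.piRep.slab 0 = [D̄ × [0,1], 1]` over the disc differs from `[D̄]` by ONE Newton–Leibniz move
  (`KZ.IntegralRep.equivalent_slab`, primitive `t`), from its restriction to `D̄ × (0,1)` by the
  null boundary `D̄ × {0,1}` (`KZ.IntegralRep.of_sub_of_restrict_mem_relations`, two coordinate
  hyperplanes), and that restriction from `ρ` by congruence of the integrands on the common domain
  (`KZ.of_sub_of_mem_relations_of_eqOn`).
* `[R] ≡ [D̄]` (`of_sub_of_piRep_mem_relations_of_chart`): the integer scaling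
  `c = R.constMul 4 = [ℝ², 4/(1+a²+b²)²]` is the honest stereographic chart of the AREA OF THE
  SPHERE, so `[c] − 4•[D̄] ∈ relations` by the landed engine `tateLifting_sphereArea`; integer
  scaling is integrand additivity, `[c] − 4•[R] ∈ relations`
  (`KZ.IntegralRep.of_constMul_nat_sub_nsmul_mem_relations`); hence `4•([R] − [D̄]) ∈ relations`
  and TORSION-FREENESS of `FormalRep ⧸ relations`
  (`BetaCancellationNegative.mem_relations_of_nsmul_mem`) divides by `4`.

Finally `[ρ] − [R] = ([ρ] − [D̄]) − ([R] − [D̄])`.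

Reference: M. Kontsevich, D. Zagier, *Periods* (2001), §1.1 eq. (1), §1.2 (rules (1)–(3)).
-/

noncomputable section

namespace Summit.KontsevichZagierPeriods.InverseLandau

open MeasureTheory Set
open Literature.NumberTheory.Transcendental
open Summit.KontsevichZagierPeriods.KontsevichZagierPeriods.BetaCancellationNegative
  (volume_setOf_apply_eq_zero mem_relations_of_nsmul_mem)

/-! ## The closed slab over the disc `KZ.piRep.slab 0 = [D̄ × [0,1], 1]` -/

/-- Membership in the domain `D̄ × [0,1] ⊆ ℝ³` of **the closed slab over the disc**
`KZ.piRep.slab 0 = [D̄ × [0,1], 1]` (the slab representation of the Newton–Leibniz format: disc in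
the coordinates `0, 1`, height `z 2 ∈ [0,1]` last), in the coordinates `z 0, z 1, z 2`.
[cite: KontsevichZagier2001, §1.2 rule (3)] -/
theorem mem_piRep_slab_domain (z : Fin 3 → ℝ) :
    z ∈ (KZ.piRep.slab 0).domain ↔ z 0 ^ 2 + z 1 ^ 2 ≤ 1 ∧ 0 ≤ z 2 ∧ z 2 ≤ 1 := by
  change (Fin.init z ∈ KZ.piDisc ∧ ((0 : ℕ) : ℝ) ≤ z (Fin.last 2) ∧
    z (Fin.last 2) ≤ ((0 : ℕ) : ℝ) + 1) ↔ _
  rw [Nat.cast_zero, zero_add, KZ.mem_piDisc]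
  exact Iff.rfl

/-- The integrand of the closed slab `KZ.piRep.slab 0` over the disc is `1`.
[cite: KontsevichZagier2001, §1.2 rule (3)] -/
theorem piRep_slab_integrand (z : Fin 3 → ℝ) : (KZ.piRep.slab 0).integrand z = 1 := rfl

/-! ## `[D̄ × (0,1), 1] ≡ [D̄]` -/

/-- **`[D̄ × (0,1), 1] − [D̄] ∈ relations`**: a representation `ρ` with domain
`{z₀² + z₁² ≤ 1, 0 < z₂ < 1}` and integrand `1` on it is the restriction of the closed slab
`KZ.piRep.slab 0 = [D̄ × [0,1], 1]` to a subdomain with null complement `D̄ × {0, 1}` (two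
coordinate hyperplanes), up to congruence of the integrands; and the slab is ONE Newton–Leibniz
move (primitive `t`, `KZ.IntegralRep.equivalent_slab`) away from the disc.
[cite: KontsevichZagier2001, §1.2] -/
theorem of_sub_of_piRep_mem_relations_of_disc_slab (ρ : KZ.IntegralRep 3)
    (hρd : ρ.domain = {z | z 0 ^ 2 + z 1 ^ 2 ≤ 1 ∧ 0 < z 2 ∧ z 2 < 1})
    (hρi : ∀ z ∈ ρ.domain, ρ.integrand z = 1) :
    KZ.of ρ - KZ.of KZ.piRep ∈ KZ.relations := by
  have hEsub : ρ.domain ⊆ (KZ.piRep.slab 0).domain := by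
    intro z hz
    rw [hρd] at hz
    obtain ⟨hdisc, h0, h1⟩ := hz
    exact (mem_piRep_slab_domain z).2 ⟨hdisc, h0.le, h1.le⟩
  -- the boundary `D̄ × {0, 1}` of the slab is null
  have hvol : volume ((KZ.piRep.slab 0).domain \ ρ.domain) = 0 := by
    refine measure_mono_null (fun w hw => ?_)
      (measure_union_null (volume_setOf_apply_eq_zero (2 : Fin 3) 0)
        (volume_setOf_apply_eq_zero (2 : Fin 3) 1))
    obtain ⟨hwS, hno⟩ := hw
    rw [mem_piRep_slab_domain] at hwS
    rw [hρd] at hno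
    obtain ⟨hdisc, h0, h1⟩ := hwS
    by_contra hc
    simp only [mem_union, mem_setOf_eq, not_or] at hc
    exact hno ⟨hdisc, lt_of_le_of_ne h0 (Ne.symm hc.1), lt_of_le_of_ne h1 hc.2⟩
  -- slab move, null boundary, congruence of the integrands
  have hA : KZ.of KZ.piRep - KZ.of (KZ.piRep.slab 0) ∈ KZ.relations := KZ.piRep.equivalent_slab 0
  have hB : KZ.of (KZ.piRep.slab 0) -
      KZ.of ((KZ.piRep.slab 0).restrict ρ.domain ρ.isSemialgebraic_domain hEsub) ∈ KZ.relations :=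
    (KZ.piRep.slab 0).of_sub_of_restrict_mem_relations ρ.isSemialgebraic_domain hEsub hvol
  have hC : KZ.of ((KZ.piRep.slab 0).restrict ρ.domain ρ.isSemialgebraic_domain hEsub) - KZ.of ρ ∈
      KZ.relations :=
    KZ.of_sub_of_mem_relations_of_eqOn rfl fun z hz => by
      rw [KZ.IntegralRep.integrand_restrict, piRep_slab_integrand]
      exact (hρi z hz).symm
  have key : KZ.of ρ - KZ.of KZ.piRep = -((KZ.of KZ.piRep - KZ.of (KZ.piRep.slab 0)) +
      (KZ.of (KZ.piRep.slab 0) -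
        KZ.of ((KZ.piRep.slab 0).restrict ρ.domain ρ.isSemialgebraic_domain hEsub)) +
      (KZ.of ((KZ.piRep.slab 0).restrict ρ.domain ρ.isSemialgebraic_domain hEsub) - KZ.of ρ)) := by
    abel
  rw [key]
  exact KZ.relations.neg_mem (KZ.relations.add_mem (KZ.relations.add_mem hA hB) hC)

/-! ## `[ℝ², (1+|w|²)⁻²] ≡ [D̄]` -/

/-- **`[ℝ², ((1+(w₀²+w₁²))²)⁻¹] − [D̄] ∈ relations`**: the integer scaling `R.constMul 4` is the
stereographic chart `[ℝ², 4/(1+a²+b²)²]` of the area of the sphere, congruent to `4•[D̄]` by the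
landed engine `tateLifting_sphereArea` and to `4•[R]` by integrand additivity
(`KZ.IntegralRep.of_constMul_nat_sub_nsmul_mem_relations`); torsion-freeness of
`FormalRep ⧸ relations` (`BetaCancellationNegative.mem_relations_of_nsmul_mem`) divides
`4•([R] − [D̄]) ∈ relations` by `4`. [cite: KontsevichZagier2001, §1.2] -/
theorem of_sub_of_piRep_mem_relations_of_chart (R : KZ.IntegralRep 2) (hRd : R.domain = Set.univ)
    (hRi : R.integrand = fun w => ((1 + (w 0 ^ 2 + w 1 ^ 2)) ^ 2)⁻¹) :
    KZ.of R - KZ.of KZ.piRep ∈ KZ.relations := by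
  have hcd : (R.constMul ((4 : ℕ) : ℝ) (isAlgebraic_nat 4)).domain = Set.univ := by
    rw [KZ.IntegralRep.domain_constMul, hRd]
  have hci : (R.constMul ((4 : ℕ) : ℝ) (isAlgebraic_nat 4)).integrand =
      fun u => 4 / (1 + u 0 ^ 2 + u 1 ^ 2) ^ 2 := by
    funext u
    simp only [KZ.IntegralRep.integrand_constMul, hRi, Nat.cast_ofNat]
    ring
  -- the area of the sphere inside the rules, and integer scaling as integrand additivity
  have h4π : KZ.of (R.constMul ((4 : ℕ) : ℝ) (isAlgebraic_nat 4)) - (4 : ℤ) • KZ.of KZ.piRep ∈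
      KZ.relations :=
    tateLifting_sphereArea _ hcd hci
  have h4R : KZ.of (R.constMul ((4 : ℕ) : ℝ) (isAlgebraic_nat 4)) - (4 : ℕ) • KZ.of R ∈
      KZ.relations :=
    R.of_constMul_nat_sub_nsmul_mem_relations 4
  have h4 : (4 : ℕ) • (KZ.of R - KZ.of KZ.piRep) ∈ KZ.relations := by
    have key : (4 : ℕ) • (KZ.of R - KZ.of KZ.piRep) =
        (KZ.of (R.constMul ((4 : ℕ) : ℝ) (isAlgebraic_nat 4)) - (4 : ℤ) • KZ.of KZ.piRep) -
        (KZ.of (R.constMul ((4 : ℕ) : ℝ) (isAlgebraic_nat 4)) - (4 : ℕ) • KZ.of R) := by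
      rw [ofNat_zsmul, smul_sub]
      abel
    rw [key]
    exact KZ.relations.sub_mem h4π h4R
  exact mem_relations_of_nsmul_mem (by norm_num) h4

/-! ## The stub -/

/-- **`[D̄ × (0,1), 1] − [ℝ², (1+|w|²)⁻²] ∈ KZ.relations`** (stub `tateLifting_unitIntervalSpin` of
line `Sketch`, crux `TateLifting`; verbatim item `UnitIntervalSpin`, stmt-KontsevichZagierPeriods-16460,
of route SpheresForWalls): a representation `ρ = [{z₀²+z₁² ≤ 1, 0 < z₂ < 1}, 1]` and a
representation `R = [ℝ², ((1+(w₀²+w₁²))²)⁻¹]` differ by relations of the Kontsevich–Zagier calculus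
(value `π` on both sides). Both are compared with the disc `[D̄, 1] = KZ.piRep`: `ρ` through the
slab Newton–Leibniz move and the null boundary `D̄ × {0,1}`
(`of_sub_of_piRep_mem_relations_of_disc_slab`), `R` through the area of the sphere inside the rules
`[ℝ², 4/(1+a²+b²)²] ≡ 4•[D̄]` (`tateLifting_sphereArea`), integer scaling and torsion-freeness
(`of_sub_of_piRep_mem_relations_of_chart`). [cite: KontsevichZagier2001, §1.2] -/
theorem tateLifting_unitIntervalSpin :
    ∀ (ρ : KZ.IntegralRep 3) (R : KZ.IntegralRep 2), ρ.domain = {z | z 0 ^ 2 + z 1 ^ 2 ≤ 1 ∧ 0 < z 2 ∧ z 2 < 1} → (∀ z ∈ ρ.domain, ρ.integrand z = 1) → R.domain = Set.univ → (R.integrand = fun w => ((1 + (w 0 ^ 2 + w 1 ^ 2)) ^ 2)⁻¹) → KZ.of ρ - KZ.of R ∈ KZ.relations := by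
  intro ρ R hρd hρi hRd hRi
  have key : KZ.of ρ - KZ.of R = (KZ.of ρ - KZ.of KZ.piRep) - (KZ.of R - KZ.of KZ.piRep) := by
    abel
  rw [key]
  exact KZ.relations.sub_mem (of_sub_of_piRep_mem_relations_of_disc_slab ρ hρd hρi)
    (of_sub_of_piRep_mem_relations_of_chart R hRd hRi)

end Summit.KontsevichZagierPeriods.InverseLandau

end
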